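import Mathlib
import Literature.NumberTheory.LFunctions.BuiHall.Sign2
import HarnessLib

/-!
# Bui–Hall sign conjecture, hub-kernel port — the analytic leg (box `BuiHallSign.lean`), part 3/3

LINE 1 — LABEL: RH-FREE (a theorem about explicit polynomial integrals — the sign of the main-term coefficient
`HARDY(k,ℓ,m,n)` of the mixed fourth moments of the derivatives of Hardy's `Z`); LADDER-RH materiality NIL
(director-rh 2026-08-27); class RECORDS → PAPERS. Nothing here bears on the truth of RH.

PROVENANCE (byte level). Hub-kernel PORT of the box file `run/shared/lean/archive/2001-boxes/rh/summits/rh-w-lgap/free/y2/lean/BuiHallSign.lean` (sha256/16 `560d5e447cc8ed51`),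
itself GENERATED by `run/shared/lean/archive/2001-boxes/rh/summits/rh-w-lgap/free/y2/lean/gen/gen_bh.py` (sha256/16 `80cee6d9d1ddbd5e`; `--assemble` from cells.json sha256
`03ab224ad42ef36c…` + certs.jsonl sha256 `240e612880cce7bc…`, run rh-lgapy2-bh-2, and the hand-written parts `gen/part_*.lean`).
This module = part 3 of 3 of the box file's body (sections: Theorem structure, Step 2 (2a): symmetry of `J J` and reduction to the triangle ; Theorem structure, Step 2 (2b'): the region kernel `W` (scratch, v3); Theorem structure, Step 2 (2d'): reorder `(v₁,v₂,s,t) → (s,t,v₁,v₂)` (scratch, v; Theorem structure, Step 2 (2c')+(2e'): the inner `(v₁,v₂)` integral of `W` is `∫; Theorem structure, Step 2 (2g) and the assembly `bhInt = (−1)^{m+n}·6·(½)^{K+4}/; Theorem structure: symmetries of `∫_Q η^k` under adjacent transpositions of the ; Assembly of Theorem BH (tex l.228–231) from the pieces).  Port edits ONLY: namespace `Literature.NumberTheory.LFunctions.BuiHall` (+ a `Part…` sub-namespace for the generated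
decision-tree names), the shared definitions block replaced by `import Literature.NumberTheory.LFunctions.BuiHall.Defs`, module split to the hub's file-size cap,
docstrings/provenance tags added; statements and proof scripts are verbatim unless a docstring says otherwise.

CONTEXT (box paper = the 2001-box write-up `work/paper-v3-d979a68f.tex`, its Theorem 13 = the Bui–Hall sign conjecture
[BuiHall2023, §1 Conjecture 1]; fidelity notes `FIDELITY-BH.md` in the box): the paper's objects (HARDY = Bui–Hall's quadruple
integral verbatim, `M` via `∫_Q`, `h_{c,d}`, `H_{c,d}`, `F_{c,d}`, `T`), the residue rule of Section 3, Lemma C, Corollary signs (a),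
Proposition oddodd's analytic step, the chart identity eq. (Tcd), Proposition 11family's implication, Section 4.1 (eq. (Lcd), the
mixture, Lemma QI, eq. (prims)) and Theorem structure are PROVED across the modules `Sign1…`; the master inequality `Λ ≤ 0` on `D`
comes from the `Certs…`/`Master…` modules; everything is assembled in module `Final` (`theorem_BH_sign`, hypothesis-free).
Intermediate statements of the box paper are kept as named Props (`StructureThm`, `ChartIdentity`, …) exactly as in the box file and
each is PROVED in these modules (`structureThm_holds`, `chartIdentity_holds`, `allEvenPos_holds`, `oddOddCore_holds`,
`elevenCore_holds`, `lemmaC_conclusions`, `mixture_holds`, `reduction_of_mixture`); none is left as a hypothesis.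
-/

set_option maxRecDepth 4000
set_option maxHeartbeats 2000000 -- generated certificate identities (`grind`) and long `linarith` calls
set_option linter.unusedVariables false -- generated cell signatures are uniform; a given certificate uses only some hypotheses
set_option linter.unusedSimpArgs false -- the generated `simp only [...]` unfolding lists are uniform across cells
set_option linter.unusedTactic false -- idem (generated scripts)
set_option linter.unreachableTactic false -- idem (generated scripts)
set_option linter.style.longLine false -- generated one-line polynomial identities
set_option linter.style.longFile 0
set_option Elab.async false

noncomputable section

namespace Literature.NumberTheory.LFunctions.BuiHall

open _root_.MeasureTheory intervalIntegral _root_.Set _root_.Filter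

/-! ## Theorem structure, Step 2 (2a): symmetry of `J J` and reduction to the triangle `v₁ ≤ v₂` (scratch, v3) -/

section struct2a
variable (k l m n : ℕ)

/-- Auxiliary lemma `Jkl_swap` of the Bui–Hall sign-conjecture leg (Theorem structure, Step 2 (2a): symmetry of `J J` and reduction to the triangle `v₁ ≤ v₂` (scratch, v3)); statement as displayed, box port verbatim. [cite: BuiHall2023, §1 Conjecture 1 — a step of THIS TREE's proof of it (box write-up paper-v3-d979a68f Theorem structure; Step 2 (2a): symmetry of `J J` and reduction to the); the cited paper states the conjecture and the proof is ours] -/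
theorem Jkl_swap (v₁ v₂ : ℝ) : Jkl k l v₂ v₁ = -Jkl k l v₁ v₂ := by
  unfold Jkl; rw [intervalIntegral.integral_symm, add_comm v₂ v₁]

/-- Auxiliary lemma `JJ_symm` of the Bui–Hall sign-conjecture leg (Theorem structure, Step 2 (2a): symmetry of `J J` and reduction to the triangle `v₁ ≤ v₂` (scratch, v3)); statement as displayed, box port verbatim. [cite: BuiHall2023, §1 Conjecture 1 — a step of THIS TREE's proof of it (box write-up paper-v3-d979a68f Theorem structure; Step 2 (2a): symmetry of `J J` and reduction to the); the cited paper states the conjecture and the proof is ours] -/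
theorem JJ_symm (v₁ v₂ : ℝ) : Jkl k l v₂ v₁ * Jkl m n v₂ v₁ = Jkl k l v₁ v₂ * Jkl m n v₁ v₂ := by
  rw [Jkl_swap k l v₁ v₂, Jkl_swap m n v₁ v₂]; ring

/-- `(v₁,v₂) ↦ J_{k,ℓ}(v₁,v₂)` is continuous [cite: BuiHall2023, §1 Conjecture 1 — a step of THIS TREE's proof of it (box write-up paper-v3-d979a68f Theorem structure; Step 2 (2a): symmetry of `J J` and reduction to the); the cited paper states the conjecture and the proof is ours] -/
theorem Jkl_continuous : Continuous (fun x : ℝ × ℝ => Jkl k l x.1 x.2) := by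
  have hf : Continuous (Function.uncurry fun (x : ℝ × ℝ) (s : ℝ) => s ^ k * (x.1 + x.2 - s) ^ l) := by
    unfold Function.uncurry; fun_prop
  have hI : ∀ (x : ℝ × ℝ) (a b : ℝ), IntervalIntegrable (fun s => s ^ k * (x.1 + x.2 - s) ^ l) volume a b :=
    fun x a b => (by fun_prop : Continuous fun s => s ^ k * (x.1 + x.2 - s) ^ l).intervalIntegrable a b
  have h2 := intervalIntegral.continuous_parametric_intervalIntegral_of_continuous (μ := volume) (a₀ := (0:ℝ)) hf
    (s := fun x : ℝ × ℝ => x.2) continuous_snd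
  have h1 := intervalIntegral.continuous_parametric_intervalIntegral_of_continuous (μ := volume) (a₀ := (0:ℝ)) hf
    (s := fun x : ℝ × ℝ => x.1) continuous_fst
  have e : (fun x : ℝ × ℝ => Jkl k l x.1 x.2)
      = fun x => (∫ s in (0:ℝ)..x.2, s ^ k * (x.1 + x.2 - s) ^ l) - ∫ s in (0:ℝ)..x.1, s ^ k * (x.1 + x.2 - s) ^ l := by
    ext x; unfold Jkl; rw [intervalIntegral.integral_interval_sub_left (hI x _ _) (hI x _ _)]
  rw [e]; exact h2.sub h1

/-- Auxiliary lemma `JJ_continuous` of the Bui–Hall sign-conjecture leg (Theorem structure, Step 2 (2a): symmetry of `J J` and reduction to the triangle `v₁ ≤ v₂` (scratch, v3)); statement as displayed, box port verbatim. [cite: BuiHall2023, §1 Conjecture 1 — a step of THIS TREE's proof of it (box write-up paper-v3-d979a68f Theorem structure; Step 2 (2a): symmetry of `J J` and reduction to the); the cited paper states the conjecture and the proof is ours] -/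
theorem JJ_continuous : Continuous (fun x : ℝ × ℝ => Jkl k l x.1 x.2 * Jkl m n x.1 x.2) :=
  (Jkl_continuous k l).mul (Jkl_continuous m n)

/-- outer integrability of a parametric integral over `I` with a kernel bounded on `I²` [cite: BuiHall2023, §1 Conjecture 1 — a step of THIS TREE's proof of it (box write-up paper-v3-d979a68f Theorem structure; Step 2 (2a): symmetry of `J J` and reduction to the); the cited paper states the conjecture and the proof is ours] -/
theorem ii_paramI {K : ℝ → ℝ → ℝ} (hK : Measurable (Function.uncurry K)) {C : ℝ}
    (hb : ∀ x ∈ Set.uIoc (-(1/2 : ℝ)) (1/2), ∀ y ∈ Set.uIoc (-(1/2 : ℝ)) (1/2), |K x y| ≤ C) :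
    IntervalIntegrable (fun x => ∫ y in (-(1/2 : ℝ))..(1/2), K x y) volume (-(1/2 : ℝ)) (1/2) := by
  have e : (fun x => ∫ y in (-(1/2 : ℝ))..(1/2), K x y) = fun x => ∫ y, K x y ∂(volume.restrict (Ioc (-(1/2 : ℝ)) (1/2))) := by
    ext x; rw [intervalIntegral.integral_of_le (by norm_num)]
  have hm : Measurable fun x => ∫ y in (-(1/2 : ℝ))..(1/2), K x y := by
    rw [e]; exact (hK.stronglyMeasurable.integral_prod_right').measurable
  refine (intervalIntegrable_const (c := C)).mono_fun hm.aestronglyMeasurable ?_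
  rw [Filter.EventuallyLE, MeasureTheory.ae_restrict_iff' measurableSet_uIoc]
  refine Filter.Eventually.of_forall fun x hx => ?_
  have := intervalIntegral.norm_integral_le_of_norm_le_const (a := (-(1/2 : ℝ))) (b := 1/2) (C := C) (f := fun y => K x y)
    (fun y hy => by rw [Real.norm_eq_abs]; exact hb x hx y hy)
  refine this.trans ?_
  have hC0 : 0 ≤ C := (abs_nonneg _).trans (hb x hx x hx)
  show C * |1/2 - -(1/2 : ℝ)| ≤ ‖C‖
  rw [Real.norm_eq_abs, abs_of_nonneg hC0]; norm_num

/-- (2a): `∫_I∫_I JJ = 2 ∫_I∫_I 1[v₁ ≤ v₂] JJ` [cite: BuiHall2023, §1 Conjecture 1 — a step of THIS TREE's proof of it (box write-up paper-v3-d979a68f Theorem structure; Step 2 (2a): symmetry of `J J` and reduction to the); the cited paper states the conjecture and the proof is ours] -/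
theorem JJ_triangle :
    ∫ v₁ in (-(1/2 : ℝ))..(1/2), ∫ v₂ in (-(1/2 : ℝ))..(1/2), Jkl k l v₁ v₂ * Jkl m n v₁ v₂
      = 2 * ∫ v₁ in (-(1/2 : ℝ))..(1/2), ∫ v₂ in (-(1/2 : ℝ))..(1/2),
          (if v₁ ≤ v₂ then Jkl k l v₁ v₂ * Jkl m n v₁ v₂ else 0) := by
  set F : ℝ → ℝ → ℝ := fun v₁ v₂ => Jkl k l v₁ v₂ * Jkl m n v₁ v₂ with hF
  have hFc : Continuous (Function.uncurry F) := by simp only [hF, Function.uncurry]; exact JJ_continuous k l m n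
  have hK : IsCompact (Set.uIcc (-(1/2 : ℝ)) (1/2) ×ˢ Set.uIcc (-(1/2 : ℝ)) (1/2)) := isCompact_uIcc.prod isCompact_uIcc
  obtain ⟨C, hC⟩ := hK.exists_bound_of_continuousOn hFc.continuousOn
  have hCb : ∀ x ∈ Set.uIoc (-(1/2 : ℝ)) (1/2), ∀ y ∈ Set.uIoc (-(1/2 : ℝ)) (1/2), |F x y| ≤ C := by
    intro x hx y hy
    have := hC (x, y) ⟨Set.uIoc_subset_uIcc hx, Set.uIoc_subset_uIcc hy⟩
    rwa [Function.uncurry, Real.norm_eq_abs] at this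
  have hFm : Measurable (Function.uncurry F) := hFc.measurable
  -- integrability of the `<` piece on the square (for the swap)
  have iGt : IntegrableOn (Function.uncurry fun v₁ v₂ : ℝ => if v₂ < v₁ then F v₁ v₂ else 0)
      (Set.uIoc (-(1/2 : ℝ)) (1/2) ×ˢ Set.uIoc (-(1/2 : ℝ)) (1/2)) := by
    have e : (Function.uncurry fun v₁ v₂ : ℝ => if v₂ < v₁ then F v₁ v₂ else 0)
        = Set.indicator {z : ℝ × ℝ | z.2 < z.1} (Function.uncurry F) := by
      ext z; simp only [Set.indicator_apply, mem_setOf_eq, Function.uncurry]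
    rw [e]
    exact ((hFc.continuousOn.integrableOn_compact hK).mono_set
      (Set.prod_mono Set.uIoc_subset_uIcc Set.uIoc_subset_uIcc)).indicator (measurableSet_lt measurable_snd measurable_fst)
  -- 1-D integrability of the pieces for fixed v₁ (indicator × continuous)
  have ipiece : ∀ (c : ℝ → ℝ → Prop) [∀ a b, Decidable (c a b)], (∀ v₁, MeasurableSet {v₂ | c v₁ v₂}) →
      ∀ v₁, IntervalIntegrable (fun v₂ => if c v₁ v₂ then F v₁ v₂ else 0) volume (-(1/2 : ℝ)) (1/2) := by
    intro c _ hc v₁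
    have hcont : Continuous fun v₂ => F v₁ v₂ := hFc.comp (Continuous.prodMk_right v₁)
    refine (hcont.intervalIntegrable _ _).mono_fun
      (Measurable.ite (hc v₁) hcont.measurable measurable_const).aestronglyMeasurable ?_
    refine Filter.Eventually.of_forall fun v₂ => ?_
    show ‖(if c v₁ v₂ then F v₁ v₂ else 0)‖ ≤ ‖F v₁ v₂‖
    split_ifs
    · exact le_rfl
    · rw [norm_zero]; exact norm_nonneg _
  have i1 := ipiece (fun v₁ v₂ => v₁ ≤ v₂) (fun v₁ => measurableSet_Ici)
  have i2 := ipiece (fun v₁ v₂ => v₂ < v₁) (fun v₁ => measurableSet_Iio)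
  -- split the inner integral
  have split : ∀ v₁, ∫ v₂ in (-(1/2 : ℝ))..(1/2), F v₁ v₂
      = (∫ v₂ in (-(1/2 : ℝ))..(1/2), (if v₁ ≤ v₂ then F v₁ v₂ else 0))
        + ∫ v₂ in (-(1/2 : ℝ))..(1/2), (if v₂ < v₁ then F v₁ v₂ else 0) := by
    intro v₁
    rw [← intervalIntegral.integral_add (i1 v₁) (i2 v₁)]
    apply intervalIntegral.integral_congr; intro v₂ _
    simp only
    by_cases h : v₁ ≤ v₂
    · rw [if_pos h, if_neg (not_lt.mpr h), add_zero]
    · rw [if_neg h, if_pos (not_le.mp h), zero_add]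
  change ∫ v₁ in (-(1/2 : ℝ))..(1/2), ∫ v₂ in (-(1/2 : ℝ))..(1/2), F v₁ v₂
    = 2 * ∫ v₁ in (-(1/2 : ℝ))..(1/2), ∫ v₂ in (-(1/2 : ℝ))..(1/2), (if v₁ ≤ v₂ then F v₁ v₂ else 0)
  simp_rw [split]
  have j1 : IntervalIntegrable (fun v₁ => ∫ v₂ in (-(1/2 : ℝ))..(1/2), (if v₁ ≤ v₂ then F v₁ v₂ else 0)) volume (-(1/2 : ℝ)) (1/2) :=
    ii_paramI (K := fun v₁ v₂ => if v₁ ≤ v₂ then F v₁ v₂ else 0)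
      (Measurable.ite (measurableSet_le measurable_fst measurable_snd) hFm measurable_const) (C := C)
      (fun x hx y hy => by
        show |(if x ≤ y then F x y else 0)| ≤ C
        split_ifs
        · exact hCb x hx y hy
        · rw [abs_zero]; exact (abs_nonneg _).trans (hCb x hx y hy))
  have j2 : IntervalIntegrable (fun v₁ => ∫ v₂ in (-(1/2 : ℝ))..(1/2), (if v₂ < v₁ then F v₁ v₂ else 0)) volume (-(1/2 : ℝ)) (1/2) :=
    ii_paramI (K := fun v₁ v₂ => if v₂ < v₁ then F v₁ v₂ else 0)
      (Measurable.ite (measurableSet_lt measurable_snd measurable_fst) hFm measurable_const) (C := C)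
      (fun x hx y hy => by
        show |(if y < x then F x y else 0)| ≤ C
        split_ifs
        · exact hCb x hx y hy
        · rw [abs_zero]; exact (abs_nonneg _).trans (hCb x hx y hy))
  rw [intervalIntegral.integral_add j1 j2, two_mul]
  congr 1
  -- the `<` piece equals the `≤` piece: swap, rename, symmetry, a.e. at the diagonal
  rw [MeasureTheory.intervalIntegral_intervalIntegral_swap iGt]
  apply intervalIntegral.integral_congr; intro x _
  apply intervalIntegral.integral_congr_ae
  filter_upwards [(Set.finite_singleton x).countable.ae_notMem volume] with y hy _
  simp only [Set.mem_singleton_iff] at hy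
  rcases lt_or_gt_of_ne hy with h | h
  · rw [if_neg (not_lt.mpr h.le), if_neg (not_le.mpr h)]
  · rw [if_pos h, if_pos h.le]
    exact JJ_symm k l m n x y

end struct2a

/-! ## Theorem structure, Step 2 (2b'): the region kernel `W` (scratch, v3) -/

section struct2w
variable (k l m n : ℕ)

/-- the polynomial `g(σ; s, t) = s^k (σ−s)^ℓ · (t^m (σ−t)^n)` [folklore] -/
noncomputable def gpoly (σ s t : ℝ) : ℝ := s ^ k * (σ - s) ^ l * (t ^ m * (σ - t) ^ n)

/-- the region kernel on `I⁴`: `1[v₁ ≤ v₂] 1[v₁≤s≤v₂] 1[v₁≤t≤v₂] g(v₁+v₂; s, t)` [folklore] -/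
noncomputable def Wreg (v₁ v₂ s t : ℝ) : ℝ :=
  if v₁ ≤ v₂ ∧ ((v₁ ≤ s ∧ s ≤ v₂) ∧ (v₁ ≤ t ∧ t ≤ v₂)) then gpoly k l m n (v₁ + v₂) s t else 0

/-- Auxiliary lemma `gpoly_continuous` of the Bui–Hall sign-conjecture leg (Theorem structure, Step 2 (2b'): the region kernel `W` (scratch, v3)); statement as displayed, box port verbatim. [cite: BuiHall2023, §1 Conjecture 1 — a step of THIS TREE's proof of it (box write-up paper-v3-d979a68f Theorem structure; Step 2 (2b'): the region kernel `W` (scratch; v3)); the cited paper states the conjecture and the proof is ours] -/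
theorem gpoly_continuous : Continuous (fun z : ℝ × ℝ × ℝ => gpoly k l m n z.1 z.2.1 z.2.2) := by
  unfold gpoly; fun_prop

/-- Auxiliary lemma `Wreg_measurable` of the Bui–Hall sign-conjecture leg (Theorem structure, Step 2 (2b'): the region kernel `W` (scratch, v3)); statement as displayed, box port verbatim. [cite: BuiHall2023, §1 Conjecture 1 — a step of THIS TREE's proof of it (box write-up paper-v3-d979a68f Theorem structure; Step 2 (2b'): the region kernel `W` (scratch; v3)); the cited paper states the conjecture and the proof is ours] -/
theorem Wreg_measurable : Measurable (fun w : ℝ × ℝ × ℝ × ℝ => Wreg k l m n w.1 w.2.1 w.2.2.1 w.2.2.2) := by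
  have p1 : Measurable fun w : ℝ × ℝ × ℝ × ℝ => w.1 := measurable_fst
  have p2 : Measurable fun w : ℝ × ℝ × ℝ × ℝ => w.2.1 := measurable_fst.comp measurable_snd
  have p3 : Measurable fun w : ℝ × ℝ × ℝ × ℝ => w.2.2.1 := measurable_fst.comp (measurable_snd.comp measurable_snd)
  have p4 : Measurable fun w : ℝ × ℝ × ℝ × ℝ => w.2.2.2 := measurable_snd.comp (measurable_snd.comp measurable_snd)
  have hS : MeasurableSet ({w : ℝ × ℝ × ℝ × ℝ | w.1 ≤ w.2.1} ∩ (({w : ℝ × ℝ × ℝ × ℝ | w.1 ≤ w.2.2.1} ∩ {w | w.2.2.1 ≤ w.2.1})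
      ∩ ({w : ℝ × ℝ × ℝ × ℝ | w.1 ≤ w.2.2.2} ∩ {w | w.2.2.2 ≤ w.2.1}))) :=
    (measurableSet_le p1 p2).inter (((measurableSet_le p1 p3).inter (measurableSet_le p3 p2)).inter
      ((measurableSet_le p1 p4).inter (measurableSet_le p4 p2)))
  have hg : Measurable fun w : ℝ × ℝ × ℝ × ℝ => gpoly k l m n (w.1 + w.2.1) w.2.2.1 w.2.2.2 :=
    (show Continuous (fun w : ℝ × ℝ × ℝ × ℝ => gpoly k l m n (w.1 + w.2.1) w.2.2.1 w.2.2.2) by unfold gpoly; fun_prop).measurable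
  have e : (fun w : ℝ × ℝ × ℝ × ℝ => Wreg k l m n w.1 w.2.1 w.2.2.1 w.2.2.2)
      = Set.indicator ({w : ℝ × ℝ × ℝ × ℝ | w.1 ≤ w.2.1} ∩ (({w : ℝ × ℝ × ℝ × ℝ | w.1 ≤ w.2.2.1} ∩ {w | w.2.2.1 ≤ w.2.1})
          ∩ ({w : ℝ × ℝ × ℝ × ℝ | w.1 ≤ w.2.2.2} ∩ {w | w.2.2.2 ≤ w.2.1})))
        (fun w => gpoly k l m n (w.1 + w.2.1) w.2.2.1 w.2.2.2) := by
    ext w; unfold Wreg; simp only [Set.indicator_apply, Set.mem_inter_iff, Set.mem_setOf_eq]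
  rw [e]; exact hg.indicator hS

/-- a uniform bound for `g` on `|σ| ≤ 1`, `|s|,|t| ≤ 1` [cite: BuiHall2023, §1 Conjecture 1 — a step of THIS TREE's proof of it (box write-up paper-v3-d979a68f Theorem structure; Step 2 (2b'): the region kernel `W` (scratch; v3)); the cited paper states the conjecture and the proof is ours] -/
theorem gpoly_abs_le {σ s t : ℝ} (hσ : |σ| ≤ 1) (hs : |s| ≤ 1) (ht : |t| ≤ 1) :
    |gpoly k l m n σ s t| ≤ 2 ^ (l + n) := by
  unfold gpoly
  have h1 : |σ - s| ≤ 2 := (abs_sub _ _).trans (by linarith)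
  have h2 : |σ - t| ≤ 2 := (abs_sub _ _).trans (by linarith)
  rw [abs_mul, abs_mul, abs_mul, abs_pow, abs_pow, abs_pow, abs_pow]
  calc |s| ^ k * |σ - s| ^ l * (|t| ^ m * |σ - t| ^ n) ≤ 1 ^ k * 2 ^ l * (1 ^ m * 2 ^ n) := by
        gcongr
    _ = 2 ^ (l + n) := by rw [one_pow, one_pow, one_mul, one_mul, pow_add]

/-- Auxiliary lemma `Wreg_abs_le` of the Bui–Hall sign-conjecture leg (Theorem structure, Step 2 (2b'): the region kernel `W` (scratch, v3)); statement as displayed, box port verbatim. [cite: BuiHall2023, §1 Conjecture 1 — a step of THIS TREE's proof of it (box write-up paper-v3-d979a68f Theorem structure; Step 2 (2b'): the region kernel `W` (scratch; v3)); the cited paper states the conjecture and the proof is ours] -/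
theorem Wreg_abs_le {v₁ v₂ s t : ℝ} (h1 : |v₁| ≤ 1/2) (h2 : |v₂| ≤ 1/2) (hs : |s| ≤ 1) (ht : |t| ≤ 1) :
    |Wreg k l m n v₁ v₂ s t| ≤ 2 ^ (l + n) := by
  unfold Wreg; split_ifs
  · apply gpoly_abs_le
    · have := abs_add_le v₁ v₂; linarith
    · exact hs
    · exact ht
  · simp

/-- (2b'): `1[v₁ ≤ v₂] J J = ∫_I∫_I W` for `v₁, v₂ ∈ I` [cite: BuiHall2023, §1 Conjecture 1 — a step of THIS TREE's proof of it (box write-up paper-v3-d979a68f Theorem structure; Step 2 (2b'): the region kernel `W` (scratch; v3)); the cited paper states the conjecture and the proof is ours] -/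
theorem JJ_eq_W {v₁ v₂ : ℝ} (h1 : v₁ ∈ Icc (-(1/2 : ℝ)) (1/2)) (h2 : v₂ ∈ Icc (-(1/2 : ℝ)) (1/2)) :
    (if v₁ ≤ v₂ then Jkl k l v₁ v₂ * Jkl m n v₁ v₂ else 0)
      = ∫ s in (-(1/2 : ℝ))..(1/2), ∫ t in (-(1/2 : ℝ))..(1/2), Wreg k l m n v₁ v₂ s t := by
  unfold Wreg
  by_cases h : v₁ ≤ v₂
  · rw [if_pos h, JJ_window k l m n h1.1 h h2.2]
    apply intervalIntegral.integral_congr; intro s _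
    apply intervalIntegral.integral_congr; intro t _
    simp only [h, true_and, gpoly]
  · rw [if_neg h]
    have e : ∀ s ∈ Set.uIcc (-(1/2 : ℝ)) (1/2), (∫ t in (-(1/2 : ℝ))..(1/2),
        (if v₁ ≤ v₂ ∧ ((v₁ ≤ s ∧ s ≤ v₂) ∧ (v₁ ≤ t ∧ t ≤ v₂)) then gpoly k l m n (v₁ + v₂) s t else 0)) = 0 := by
      intro s _
      have e2 : ∀ t ∈ Set.uIcc (-(1/2 : ℝ)) (1/2),
          (if v₁ ≤ v₂ ∧ ((v₁ ≤ s ∧ s ≤ v₂) ∧ (v₁ ≤ t ∧ t ≤ v₂)) then gpoly k l m n (v₁ + v₂) s t else 0) = 0 := by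
        intro t _; rw [if_neg (fun hh => h hh.1)]
      rw [intervalIntegral.integral_congr e2]; simp
    rw [intervalIntegral.integral_congr e]; simp

end struct2w

/-! ## Theorem structure, Step 2 (2d'): reorder `(v₁,v₂,s,t) → (s,t,v₁,v₂)` (scratch, v3) -/

section struct2d
variable (k l m n : ℕ)

local notation "hI" => (by norm_num : (-(1/2 : ℝ)) ≤ 1/2)

/-- Auxiliary lemma `abs_le_half_of_uIoc` of the Bui–Hall sign-conjecture leg (Theorem structure, Step 2 (2d'): reorder `(v₁,v₂,s,t) → (s,t,v₁,v₂)` (scratch, v3)); statement as displayed, box port verbatim. [cite: BuiHall2023, §1 Conjecture 1 — a step of THIS TREE's proof of it (box write-up paper-v3-d979a68f Theorem structure; Step 2 (2d'): reorder `(v₁;v₂;s;t) → (s;t;v₁;v₂)` (); the cited paper states the conjecture and the proof is ours] -/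
theorem abs_le_half_of_uIoc {x : ℝ} (hx : x ∈ Set.uIoc (-(1/2 : ℝ)) (1/2)) : |x| ≤ 1/2 := by
  rw [Set.uIoc_of_le (by norm_num)] at hx; rw [abs_le]; constructor <;> linarith [hx.1, hx.2]

/-- Auxiliary lemma `abs_le_half_of_uIcc` of the Bui–Hall sign-conjecture leg (Theorem structure, Step 2 (2d'): reorder `(v₁,v₂,s,t) → (s,t,v₁,v₂)` (scratch, v3)); statement as displayed, box port verbatim. [cite: BuiHall2023, §1 Conjecture 1 — a step of THIS TREE's proof of it (box write-up paper-v3-d979a68f Theorem structure; Step 2 (2d'): reorder `(v₁;v₂;s;t) → (s;t;v₁;v₂)` (); the cited paper states the conjecture and the proof is ours] -/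
theorem abs_le_half_of_uIcc {x : ℝ} (hx : x ∈ Set.uIcc (-(1/2 : ℝ)) (1/2)) : |x| ≤ 1/2 := by
  rw [Set.uIcc_of_le (by norm_num)] at hx; rw [abs_le]; constructor <;> linarith [hx.1, hx.2]

/-- generic: swap two adjacent `I`-integrals of a kernel bounded on `I²` [cite: BuiHall2023, §1 Conjecture 1 — a step of THIS TREE's proof of it (box write-up paper-v3-d979a68f Theorem structure; Step 2 (2d'): reorder `(v₁;v₂;s;t) → (s;t;v₁;v₂)` (); the cited paper states the conjecture and the proof is ours] -/
theorem swapI {K : ℝ → ℝ → ℝ} (hK : Measurable (Function.uncurry K)) {C : ℝ}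
    (hb : ∀ x ∈ Set.uIoc (-(1/2 : ℝ)) (1/2), ∀ y ∈ Set.uIoc (-(1/2 : ℝ)) (1/2), |K x y| ≤ C) :
    ∫ x in (-(1/2 : ℝ))..(1/2), ∫ y in (-(1/2 : ℝ))..(1/2), K x y
      = ∫ y in (-(1/2 : ℝ))..(1/2), ∫ x in (-(1/2 : ℝ))..(1/2), K x y := by
  rw [MeasureTheory.intervalIntegral_intervalIntegral_swap]
  refine integrableOn_rect_of_bdd' (K := Function.uncurry K) hK (C := C) ?_
  rintro ⟨x, y⟩ ⟨hx, hy⟩; exact hb x hx y hy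

/-- measurability of a parametric `I`-integral of a jointly measurable kernel [cite: BuiHall2023, §1 Conjecture 1 — a step of THIS TREE's proof of it (box write-up paper-v3-d979a68f Theorem structure; Step 2 (2d'): reorder `(v₁;v₂;s;t) → (s;t;v₁;v₂)` (); the cited paper states the conjecture and the proof is ours] -/
theorem measurable_paramI {α : Type*} [MeasurableSpace α] {K : α → ℝ → ℝ} (hK : Measurable (Function.uncurry K)) :
    Measurable (fun z : α => ∫ y in (-(1/2 : ℝ))..(1/2), K z y) := by
  have e : (fun z : α => ∫ y in (-(1/2 : ℝ))..(1/2), K z y)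
      = fun z => ∫ y, K z y ∂(volume.restrict (Ioc (-(1/2 : ℝ)) (1/2))) := by
    ext z; rw [intervalIntegral.integral_of_le (by norm_num)]
  rw [e]
  exact (hK.stronglyMeasurable.integral_prod_right').measurable

/-- Auxiliary lemma `abs_integralI_le` of the Bui–Hall sign-conjecture leg (Theorem structure, Step 2 (2d'): reorder `(v₁,v₂,s,t) → (s,t,v₁,v₂)` (scratch, v3)); statement as displayed, box port verbatim. [cite: BuiHall2023, §1 Conjecture 1 — a step of THIS TREE's proof of it (box write-up paper-v3-d979a68f Theorem structure; Step 2 (2d'): reorder `(v₁;v₂;s;t) → (s;t;v₁;v₂)` (); the cited paper states the conjecture and the proof is ours] -/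
theorem abs_integralI_le {f : ℝ → ℝ} {C : ℝ} (hb : ∀ y ∈ Set.uIoc (-(1/2 : ℝ)) (1/2), |f y| ≤ C) :
    |∫ y in (-(1/2 : ℝ))..(1/2), f y| ≤ C := by
  have := intervalIntegral.norm_integral_le_of_norm_le_const (a := (-(1/2 : ℝ))) (b := 1/2) (C := C) (f := f)
    (fun y hy => by rw [Real.norm_eq_abs]; exact hb y hy)
  rw [Real.norm_eq_abs] at this; norm_num at this; exact this

/-- (2d'): `∫_{v₁}∫_{v₂}∫_s∫_t W = ∫_s∫_t∫_{v₁}∫_{v₂} W` [cite: BuiHall2023, §1 Conjecture 1 — a step of THIS TREE's proof of it (box write-up paper-v3-d979a68f Theorem structure; Step 2 (2d'): reorder `(v₁;v₂;s;t) → (s;t;v₁;v₂)` (); the cited paper states the conjecture and the proof is ours] -/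
theorem W_reorder :
    ∫ v₁ in (-(1/2 : ℝ))..(1/2), ∫ v₂ in (-(1/2 : ℝ))..(1/2), ∫ s in (-(1/2 : ℝ))..(1/2), ∫ t in (-(1/2 : ℝ))..(1/2),
        Wreg k l m n v₁ v₂ s t
      = ∫ s in (-(1/2 : ℝ))..(1/2), ∫ t in (-(1/2 : ℝ))..(1/2), ∫ v₁ in (-(1/2 : ℝ))..(1/2), ∫ v₂ in (-(1/2 : ℝ))..(1/2),
        Wreg k l m n v₁ v₂ s t := by
  have hW := Wreg_measurable k l m n
  have hWb : ∀ v₁ v₂ s t : ℝ, |v₁| ≤ 1/2 → |v₂| ≤ 1/2 → |s| ≤ 1/2 → |t| ≤ 1/2 → |Wreg k l m n v₁ v₂ s t| ≤ 2 ^ (l + n) :=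
    fun v₁ v₂ s t h1 h2 hs ht => Wreg_abs_le k l m n h1 h2 (hs.trans (by norm_num)) (ht.trans (by norm_num))
  -- S1: for fixed v₁, swap (v₂, s)
  have S1 : ∀ v₁ ∈ Set.uIcc (-(1/2 : ℝ)) (1/2),
      (∫ v₂ in (-(1/2 : ℝ))..(1/2), ∫ s in (-(1/2 : ℝ))..(1/2), ∫ t in (-(1/2 : ℝ))..(1/2), Wreg k l m n v₁ v₂ s t)
        = ∫ s in (-(1/2 : ℝ))..(1/2), ∫ v₂ in (-(1/2 : ℝ))..(1/2), ∫ t in (-(1/2 : ℝ))..(1/2), Wreg k l m n v₁ v₂ s t := by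
    intro v₁ hv₁
    have h1 := abs_le_half_of_uIcc hv₁
    refine swapI (K := fun v₂ s => ∫ t in (-(1/2 : ℝ))..(1/2), Wreg k l m n v₁ v₂ s t) ?_ (C := 2 ^ (l + n)) ?_
    · exact measurable_paramI (K := fun (z : ℝ × ℝ) t => Wreg k l m n v₁ z.1 z.2 t)
        (hW.comp (measurable_const.prodMk ((measurable_fst.comp measurable_fst).prodMk
          ((measurable_snd.comp measurable_fst).prodMk measurable_snd))))
    · intro v₂ hv₂ s hs
      exact abs_integralI_le fun t ht => hWb _ _ _ _ h1 (abs_le_half_of_uIoc hv₂) (abs_le_half_of_uIoc hs) (abs_le_half_of_uIoc ht)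
  rw [intervalIntegral.integral_congr S1]
  -- S2: swap (v₁, s) — doubly parametric
  have S2 : (∫ v₁ in (-(1/2 : ℝ))..(1/2), ∫ s in (-(1/2 : ℝ))..(1/2), ∫ v₂ in (-(1/2 : ℝ))..(1/2), ∫ t in (-(1/2 : ℝ))..(1/2),
        Wreg k l m n v₁ v₂ s t)
      = ∫ s in (-(1/2 : ℝ))..(1/2), ∫ v₁ in (-(1/2 : ℝ))..(1/2), ∫ v₂ in (-(1/2 : ℝ))..(1/2), ∫ t in (-(1/2 : ℝ))..(1/2),
        Wreg k l m n v₁ v₂ s t := by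
    refine swapI (K := fun v₁ s => ∫ v₂ in (-(1/2 : ℝ))..(1/2), ∫ t in (-(1/2 : ℝ))..(1/2), Wreg k l m n v₁ v₂ s t) ?_
      (C := 2 ^ (l + n)) ?_
    · -- ((v₁,s),v₂) ↦ ∫_t W is measurable, then integrate over v₂
      have inner : Measurable (fun w : (ℝ × ℝ) × ℝ => ∫ t in (-(1/2 : ℝ))..(1/2), Wreg k l m n w.1.1 w.2 w.1.2 t) :=
        measurable_paramI (K := fun (w : (ℝ × ℝ) × ℝ) t => Wreg k l m n w.1.1 w.2 w.1.2 t)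
          (hW.comp (((measurable_fst.comp measurable_fst).comp measurable_fst).prodMk
            ((measurable_snd.comp measurable_fst).prodMk
              (((measurable_snd.comp measurable_fst).comp measurable_fst).prodMk measurable_snd))))
      exact measurable_paramI (K := fun (z : ℝ × ℝ) v₂ => ∫ t in (-(1/2 : ℝ))..(1/2), Wreg k l m n z.1 v₂ z.2 t) inner
    · intro v₁ hv₁ s hs
      exact abs_integralI_le fun v₂ hv₂ => abs_integralI_le fun t ht =>
        hWb _ _ _ _ (abs_le_half_of_uIoc hv₁) (abs_le_half_of_uIoc hv₂) (abs_le_half_of_uIoc hs) (abs_le_half_of_uIoc ht)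
  rw [S2]
  apply intervalIntegral.integral_congr; intro s hs
  have hs' := abs_le_half_of_uIcc hs
  simp only
  -- S3: for fixed s, v₁: swap (v₂, t)
  have S3 : ∀ v₁ ∈ Set.uIcc (-(1/2 : ℝ)) (1/2),
      (∫ v₂ in (-(1/2 : ℝ))..(1/2), ∫ t in (-(1/2 : ℝ))..(1/2), Wreg k l m n v₁ v₂ s t)
        = ∫ t in (-(1/2 : ℝ))..(1/2), ∫ v₂ in (-(1/2 : ℝ))..(1/2), Wreg k l m n v₁ v₂ s t := by
    intro v₁ hv₁
    refine swapI (K := fun v₂ t => Wreg k l m n v₁ v₂ s t) ?_ (C := 2 ^ (l + n)) ?_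
    · exact hW.comp (measurable_const.prodMk (measurable_fst.prodMk (measurable_const.prodMk measurable_snd)))
    · intro v₂ hv₂ t ht
      exact hWb _ _ _ _ (abs_le_half_of_uIcc hv₁) (abs_le_half_of_uIoc hv₂) hs' (abs_le_half_of_uIoc ht)
  rw [intervalIntegral.integral_congr S3]
  -- S4: swap (v₁, t)
  refine swapI (K := fun v₁ t => ∫ v₂ in (-(1/2 : ℝ))..(1/2), Wreg k l m n v₁ v₂ s t) ?_ (C := 2 ^ (l + n)) ?_
  · exact measurable_paramI (K := fun (z : ℝ × ℝ) v₂ => Wreg k l m n z.1 v₂ s z.2)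
      (hW.comp ((measurable_fst.comp measurable_fst).prodMk (measurable_snd.prodMk
        (measurable_const.prodMk (measurable_snd.comp measurable_fst)))))
  · intro v₁ hv₁ t ht
    exact abs_integralI_le fun v₂ hv₂ =>
      hWb _ _ _ _ (abs_le_half_of_uIoc hv₁) (abs_le_half_of_uIoc hv₂) hs' (abs_le_half_of_uIoc ht)

end struct2d

/-! ## Theorem structure, Step 2 (2c')+(2e'): the inner `(v₁,v₂)` integral of `W` is `∫ g(σ) (½ − ‖ξ‖∞)₊ dσ` (scratch, v3) -/

section struct2c
variable (k l m n : ℕ)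

/-- integrals of a function vanishing off `[p, q] ⊆ [a, b]` [cite: BuiHall2023, §1 Conjecture 1 — a step of THIS TREE's proof of it (box write-up paper-v3-d979a68f Theorem structure; Step 2 (2c')+(2e'): the inner `(v₁;v₂)` integral of); the cited paper states the conjecture and the proof is ours] -/
theorem integral_eq_of_vanish_off {f : ℝ → ℝ} {p q a b : ℝ} (hpq : p ≤ q) (hap : a ≤ p) (hqb : q ≤ b)
    (hf : ∀ x, x < p ∨ q < x → f x = 0) (hfi : ∀ c d, IntervalIntegrable f volume c d) :
    ∫ x in a..b, f x = ∫ x in p..q, f x := by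
  rw [← intervalIntegral.integral_add_adjacent_intervals (hfi a p) (hfi p b),
    ← intervalIntegral.integral_add_adjacent_intervals (hfi p q) (hfi q b)]
  have z1 : ∫ x in a..p, f x = 0 := by
    rw [intervalIntegral.integral_of_le hap, integral_Ioc_eq_integral_Ioo]
    exact MeasureTheory.setIntegral_eq_zero_of_forall_eq_zero fun x hx => hf x (Or.inl hx.2)
  have z2 : ∫ x in q..b, f x = 0 := by
    rw [intervalIntegral.integral_of_le hqb]
    exact MeasureTheory.setIntegral_eq_zero_of_forall_eq_zero fun x hx => hf x (Or.inr hx.1)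
  rw [z1, z2, zero_add, add_zero]

/-- the kernel in the `σ = v₁ + v₂` variable, with the range indicator (the condition of `fibre_v1`) [folklore] -/
noncomputable def Wsig (s t v σ : ℝ) : ℝ :=
  if (v ≤ σ - v ∧ |σ - v| ≤ 1/2) ∧ ((v ≤ s ∧ s ≤ σ - v) ∧ (v ≤ t ∧ t ≤ σ - v)) then gpoly k l m n σ s t else 0

/-- Auxiliary lemma `Wsig_measurable` of the Bui–Hall sign-conjecture leg (Theorem structure, Step 2 (2c')+(2e'): the inner `(v₁,v₂)` integral of `W` is `∫ g(σ) (½ − ‖ξ‖∞)₊ dσ` (scra…); statement as displayed, box port verbatim. [cite: BuiHall2023, §1 Conjecture 1 — a step of THIS TREE's proof of it (box write-up paper-v3-d979a68f Theorem structure; Step 2 (2c')+(2e'): the inner `(v₁;v₂)` integral of); the cited paper states the conjecture and the proof is ours] -/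
theorem Wsig_measurable (s t : ℝ) : Measurable (Function.uncurry (Wsig k l m n s t)) := by
  have p1 : Measurable fun w : ℝ × ℝ => w.1 := measurable_fst
  have p2 : Measurable fun w : ℝ × ℝ => w.2 - w.1 := measurable_snd.sub measurable_fst
  have hS : MeasurableSet (({w : ℝ × ℝ | w.1 ≤ w.2 - w.1} ∩ {w : ℝ × ℝ | |w.2 - w.1| ≤ 1/2})
      ∩ (({w : ℝ × ℝ | w.1 ≤ s} ∩ {w : ℝ × ℝ | s ≤ w.2 - w.1}) ∩ ({w : ℝ × ℝ | w.1 ≤ t} ∩ {w : ℝ × ℝ | t ≤ w.2 - w.1}))) :=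
    ((measurableSet_le p1 p2).inter (measurableSet_le (p2.abs) measurable_const)).inter
      (((measurableSet_le p1 measurable_const).inter (measurableSet_le measurable_const p2)).inter
        ((measurableSet_le p1 measurable_const).inter (measurableSet_le measurable_const p2)))
  have hg : Measurable fun w : ℝ × ℝ => gpoly k l m n w.2 s t :=
    (show Continuous (fun w : ℝ × ℝ => gpoly k l m n w.2 s t) by unfold gpoly; fun_prop).measurable
  have e : Function.uncurry (Wsig k l m n s t)
      = Set.indicator (({w : ℝ × ℝ | w.1 ≤ w.2 - w.1} ∩ {w : ℝ × ℝ | |w.2 - w.1| ≤ 1/2})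
          ∩ (({w : ℝ × ℝ | w.1 ≤ s} ∩ {w : ℝ × ℝ | s ≤ w.2 - w.1}) ∩ ({w : ℝ × ℝ | w.1 ≤ t} ∩ {w : ℝ × ℝ | t ≤ w.2 - w.1})))
        (fun w => gpoly k l m n w.2 s t) := by
    ext ⟨v, σ⟩; unfold Wsig; simp only [Function.uncurry, Set.indicator_apply, Set.mem_inter_iff, Set.mem_setOf_eq]
  rw [e]; exact hg.indicator hS

/-- Auxiliary lemma `Wsig_abs_le` of the Bui–Hall sign-conjecture leg (Theorem structure, Step 2 (2c')+(2e'): the inner `(v₁,v₂)` integral of `W` is `∫ g(σ) (½ − ‖ξ‖∞)₊ dσ` (scra…); statement as displayed, box port verbatim. [cite: BuiHall2023, §1 Conjecture 1 — a step of THIS TREE's proof of it (box write-up paper-v3-d979a68f Theorem structure; Step 2 (2c')+(2e'): the inner `(v₁;v₂)` integral of); the cited paper states the conjecture and the proof is ours] -/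
theorem Wsig_abs_le {s t v σ : ℝ} (hs : |s| ≤ 1/2) (ht : |t| ≤ 1/2) (hv : |v| ≤ 1/2) : |Wsig k l m n s t v σ| ≤ 2 ^ (l + n) := by
  unfold Wsig; split_ifs with h
  · apply gpoly_abs_le
    · have h1 := h.1.2; have := abs_le.mp h1; have := abs_le.mp hv
      rw [abs_le]; constructor <;> linarith
    · exact hs.trans (by norm_num)
    · exact ht.trans (by norm_num)
  · simp

/-- Auxiliary lemma `Wsig_vanish` of the Bui–Hall sign-conjecture leg (Theorem structure, Step 2 (2c')+(2e'): the inner `(v₁,v₂)` integral of `W` is `∫ g(σ) (½ − ‖ξ‖∞)₊ dσ` (scra…); statement as displayed, box port verbatim. [cite: BuiHall2023, §1 Conjecture 1 — a step of THIS TREE's proof of it (box write-up paper-v3-d979a68f Theorem structure; Step 2 (2c')+(2e'): the inner `(v₁;v₂)` integral of); the cited paper states the conjecture and the proof is ours] -/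
theorem Wsig_vanish {s t v σ : ℝ} (hv : |v| ≤ 1/2) (hσ : σ < -1 ∨ 1 < σ) : Wsig k l m n s t v σ = 0 := by
  unfold Wsig; rw [if_neg]; intro h
  have := abs_le.mp h.1.2; have := abs_le.mp hv
  rcases hσ with h' | h' <;> linarith

/-- (2c'): for `v ∈ I`: `∫_{v₂ ∈ I} W v v₂ s t dv₂ = ∫_{σ ∈ [-1,1]} Wsig s t v σ dσ` [cite: BuiHall2023, §1 Conjecture 1 — a step of THIS TREE's proof of it (box write-up paper-v3-d979a68f Theorem structure; Step 2 (2c')+(2e'): the inner `(v₁;v₂)` integral of); the cited paper states the conjecture and the proof is ours] -/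
theorem W_to_sigma {s t v : ℝ} (hs : |s| ≤ 1/2) (ht : |t| ≤ 1/2) (hv : v ∈ Icc (-(1/2 : ℝ)) (1/2)) :
    ∫ v₂ in (-(1/2 : ℝ))..(1/2), Wreg k l m n v v₂ s t = ∫ σ in (-1:ℝ)..1, Wsig k l m n s t v σ := by
  have hv' : |v| ≤ 1/2 := abs_le.mpr ⟨hv.1, hv.2⟩
  -- on the range, W v v₂ s t = Wsig s t v (v + v₂)
  have e1 : ∀ v₂ ∈ Set.uIcc (-(1/2 : ℝ)) (1/2), Wreg k l m n v v₂ s t = Wsig k l m n s t v (v + v₂) := by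
    intro v₂ hv₂
    have h2 := abs_le_half_of_uIcc hv₂
    unfold Wreg Wsig
    simp only [add_sub_cancel_left, h2, and_true]
  rw [intervalIntegral.integral_congr e1, intervalIntegral.integral_comp_add_left (fun σ => Wsig k l m n s t v σ) v]
  -- range [v - ½, v + ½] → [-1, 1]
  symm
  apply integral_eq_of_vanish_off (by linarith) (by linarith [hv.1]) (by linarith [hv.2])
  · intro σ hσ
    unfold Wsig; rw [if_neg]; intro h
    have := abs_le.mp h.1.2
    rcases hσ with h' | h' <;> linarith
  · intro c d
    exact ii_of_bdd_meas' ((Wsig_measurable k l m n s t).comp (measurable_const.prodMk measurable_id))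
      (fun σ => Wsig_abs_le k l m n hs ht hv') c d

/-- (2e'): `∫_{v ∈ I}∫_{v₂ ∈ I} W = ∫_{σ∈[-1,1]} g(σ;s,t) (½ − ‖(s, σ−s, −t, t−σ)‖∞)₊ dσ` [cite: BuiHall2023, §1 Conjecture 1 — a step of THIS TREE's proof of it (box write-up paper-v3-d979a68f Theorem structure; Step 2 (2c')+(2e'): the inner `(v₁;v₂)` integral of); the cited paper states the conjecture and the proof is ours] -/
theorem W_fibre {s t : ℝ} (hs : |s| ≤ 1/2) (ht : |t| ≤ 1/2) :
    ∫ v in (-(1/2 : ℝ))..(1/2), ∫ v₂ in (-(1/2 : ℝ))..(1/2), Wreg k l m n v v₂ s t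
      = ∫ σ in (-1:ℝ)..1, gpoly k l m n σ s t * max (1/2 - supN s (σ - s) (-t)) 0 := by
  have e1 : ∀ v ∈ Set.uIcc (-(1/2 : ℝ)) (1/2), (∫ v₂ in (-(1/2 : ℝ))..(1/2), Wreg k l m n v v₂ s t)
      = ∫ σ in (-1:ℝ)..1, Wsig k l m n s t v σ := by
    intro v hv; rw [Set.uIcc_of_le (by norm_num)] at hv; exact W_to_sigma k l m n hs ht hv
  rw [intervalIntegral.integral_congr e1, MeasureTheory.intervalIntegral_intervalIntegral_swap]
  · apply intervalIntegral.integral_congr; intro σ _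
    simp only
    -- ∫_v Wsig = g(σ) · ∫_v 1[cond] = g(σ) · tent
    rw [← fibre_v1 hs ht (σ := σ), ← intervalIntegral.integral_const_mul]
    apply intervalIntegral.integral_congr; intro v _
    unfold Wsig; simp only; split_ifs <;> simp
  · refine integrableOn_rect_of_bdd' (Wsig_measurable k l m n s t) (C := 2 ^ (l + n)) ?_
    rintro ⟨v, σ⟩ ⟨hv, _⟩
    exact Wsig_abs_le k l m n hs ht (abs_le_half_of_uIoc hv)

end struct2c

/-! ## Theorem structure, Step 2 (2g) and the assembly `bhInt = (−1)^{m+n}·6·(½)^{K+4}/(K+4)·∫_Q` (scratch, v3) -/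

section struct2g
variable (k l m n : ℕ)

/-- Auxiliary lemma `tent_continuous` of the Bui–Hall sign-conjecture leg (Theorem structure, Step 2 (2g) and the assembly `bhInt = (−1)^{m+n}·6·(½)^{K+4}/(K+4)·∫_Q` (scratch, v3)); statement as displayed, box port verbatim. [cite: BuiHall2023, §1 Conjecture 1 — a step of THIS TREE's proof of it (box write-up paper-v3-d979a68f Theorem structure; Step 2 (2g) and the assembly `bhInt = (−1)^{m+n}·6·); the cited paper states the conjecture and the proof is ours] -/
theorem tent_continuous : Continuous (fun z : ℝ × ℝ × ℝ => max (1/2 - supN z.1 z.2.1 z.2.2) 0) := by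
  unfold supN; fun_prop

/-- (2g): `∫_{t∈I}∫_{σ∈[-1,1]} g(σ;s,t)·tent(s,σ−s,−t) = (−1)^{m+n} ∫_{b∈I}∫_{e∈I} monoQ s b e · tent(s,b,e)` for `s ∈ I` [cite: BuiHall2023, §1 Conjecture 1 — a step of THIS TREE's proof of it (box write-up paper-v3-d979a68f Theorem structure; Step 2 (2g) and the assembly `bhInt = (−1)^{m+n}·6·); the cited paper states the conjecture and the proof is ours] -/
theorem sigma_to_be {s : ℝ} (hs : |s| ≤ 1/2) :
    ∫ t in (-(1/2 : ℝ))..(1/2), ∫ σ in (-1:ℝ)..1, gpoly k l m n σ s t * max (1/2 - supN s (σ - s) (-t)) 0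
      = (-1) ^ (m + n) * ∫ b in (-(1/2 : ℝ))..(1/2), ∫ e in (-(1/2 : ℝ))..(1/2),
          monoQ k l m n s b e * max (1/2 - supN s b e) 0 := by
  have hs' := abs_le.mp hs
  set Φ : ℝ → ℝ → ℝ := fun σ t => gpoly k l m n σ s t * max (1/2 - supN s (σ - s) (-t)) 0 with hΦ
  have hΦc : Continuous (Function.uncurry Φ) := by
    simp only [hΦ, Function.uncurry]
    refine Continuous.mul (by unfold gpoly; fun_prop) ?_
    exact tent_continuous.comp (by fun_prop : Continuous fun z : ℝ × ℝ => (s, z.1 - s, -z.2))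
  -- swap (t, σ)
  have sw : ∫ t in (-(1/2 : ℝ))..(1/2), ∫ σ in (-1:ℝ)..1, Φ σ t = ∫ σ in (-1:ℝ)..1, ∫ t in (-(1/2 : ℝ))..(1/2), Φ σ t := by
    rw [MeasureTheory.intervalIntegral_intervalIntegral_swap]
    have hK : IsCompact (Set.uIcc (-(1/2 : ℝ)) (1/2) ×ˢ Set.uIcc (-1:ℝ) 1) := isCompact_uIcc.prod isCompact_uIcc
    have hc : Continuous (Function.uncurry fun t σ => Φ σ t) :=
      hΦc.comp (by fun_prop : Continuous fun z : ℝ × ℝ => (z.2, z.1))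
    exact (hc.continuousOn.integrableOn_compact hK).mono_set (Set.prod_mono Set.uIoc_subset_uIcc Set.uIoc_subset_uIcc)
  change ∫ t in (-(1/2 : ℝ))..(1/2), ∫ σ in (-1:ℝ)..1, Φ σ t = _
  rw [sw]
  -- σ ↦ b + s
  set Ψ : ℝ → ℝ := fun σ => ∫ t in (-(1/2 : ℝ))..(1/2), Φ σ t with hΨ
  have hΨc : Continuous Ψ := intervalIntegral.continuous_parametric_intervalIntegral_of_continuous' hΦc _ _
  have shift : ∫ σ in (-1:ℝ)..1, Ψ σ = ∫ b in (-1 - s)..(1 - s), Ψ (b + s) := by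
    rw [intervalIntegral.integral_comp_add_right (fun σ => Ψ σ) s]; congr 1 <;> ring
  change ∫ σ in (-1:ℝ)..1, Ψ σ = _
  rw [shift]
  -- normalize the b-range to I (Ψ(b+s) vanishes for |b| > ½)
  have van : ∀ b, b < -(1/2 : ℝ) ∨ 1/2 < b → Ψ (b + s) = 0 := by
    intro b hb
    simp only [hΨ, hΦ]
    have e : ∀ t ∈ Set.uIcc (-(1/2 : ℝ)) (1/2), gpoly k l m n (b + s) s t * max (1/2 - supN s (b + s - s) (-t)) 0 = 0 := by
      intro t _
      have hb' : 1/2 < |b| := by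
        rcases hb with h | h
        · rw [abs_of_neg (by linarith)]; linarith
        · rw [abs_of_pos (by linarith)]; linarith
      have : supN s (b + s - s) (-t) ≥ |b| := by
        unfold supN; rw [add_sub_cancel_right]; exact (le_max_right _ _).trans (le_max_left _ _)
      rw [max_eq_right (by linarith), mul_zero]
    rw [intervalIntegral.integral_congr e]; simp
  rw [integral_eq_of_vanish_off (f := fun b => Ψ (b + s)) (by norm_num) (by linarith) (by linarith) van
    (fun c d => (hΨc.comp (continuous_id.add continuous_const)).intervalIntegrable c d)]
  rw [← intervalIntegral.integral_const_mul]
  apply intervalIntegral.integral_congr; intro b _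
  simp only [hΨ, hΦ]
  -- t ↦ -e and the pointwise identity
  rw [← intervalIntegral.integral_const_mul]
  have cn := intervalIntegral.integral_comp_neg (a := (-(1/2 : ℝ))) (b := 1/2)
    (fun e => gpoly k l m n (b + s) s e * max (1/2 - supN s (b + s - s) (-e)) 0)
  rw [show -(1/2 : ℝ) = -(1/2) from rfl, neg_neg] at cn
  rw [← cn]
  apply intervalIntegral.integral_congr; intro e _
  simp only [neg_neg, add_sub_cancel_right]
  unfold gpoly monoQ
  rw [show b + s - (-e) = -(-s - b - e) by ring, neg_pow (-s - b - e), neg_pow e, add_sub_cancel_right, pow_add]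
  ring

/-- **Steps 1–3 assembled**: `bhInt k ℓ m n = (−1)^{m+n} · 6 · (½)^{K+4}/(K+4) · ∫_Q η^k` [cite: BuiHall2023, §1 Conjecture 1 — a step of THIS TREE's proof of it (box write-up paper-v3-d979a68f Theorem structure; Step 2 (2g) and the assembly `bhInt = (−1)^{m+n}·6·); the cited paper states the conjecture and the proof is ours] -/
theorem bhInt_eq_intQ :
    bhInt k l m n = (-1) ^ (m + n) * 6 * ((1/2 : ℝ) ^ (k + l + m + n + 4) / ((k + l + m + n : ℕ) + 4))
      * intQ (fun a b e f => a ^ k * b ^ l * e ^ m * f ^ n) := by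
  rw [bhInt_eq_JJ, JJ_triangle]
  have e1 : ∀ v₁ ∈ Set.uIcc (-(1/2 : ℝ)) (1/2), (∫ v₂ in (-(1/2 : ℝ))..(1/2),
      (if v₁ ≤ v₂ then Jkl k l v₁ v₂ * Jkl m n v₁ v₂ else 0))
        = ∫ v₂ in (-(1/2 : ℝ))..(1/2), ∫ s in (-(1/2 : ℝ))..(1/2), ∫ t in (-(1/2 : ℝ))..(1/2), Wreg k l m n v₁ v₂ s t := by
    intro v₁ hv₁
    rw [Set.uIcc_of_le (by norm_num)] at hv₁
    apply intervalIntegral.integral_congr; intro v₂ hv₂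
    rw [Set.uIcc_of_le (by norm_num)] at hv₂
    exact JJ_eq_W k l m n hv₁ hv₂
  rw [intervalIntegral.integral_congr e1, W_reorder]
  have e2 : ∀ s ∈ Set.uIcc (-(1/2 : ℝ)) (1/2), (∫ t in (-(1/2 : ℝ))..(1/2), ∫ v₁ in (-(1/2 : ℝ))..(1/2),
      ∫ v₂ in (-(1/2 : ℝ))..(1/2), Wreg k l m n v₁ v₂ s t)
        = (-1) ^ (m + n) * ∫ b in (-(1/2 : ℝ))..(1/2), ∫ e in (-(1/2 : ℝ))..(1/2), monoQ k l m n s b e * max (1/2 - supN s b e) 0 := by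
    intro s hs
    have hs' := abs_le_half_of_uIcc hs
    rw [← sigma_to_be k l m n hs']
    apply intervalIntegral.integral_congr; intro t ht
    exact W_fibre k l m n hs' (abs_le_half_of_uIcc ht)
  rw [intervalIntegral.integral_congr e2, intervalIntegral.integral_const_mul, tent_eq_intQ]
  ring

end struct2g

/-! ## Theorem structure: symmetries of `∫_Q η^k` under adjacent transpositions of the exponents (scratch, v3) -/

section structsym

/-- the `∫_Q` integrand for general exponents [folklore] -/
noncomputable def Qint (k₁ k₂ k₃ k₄ : ℕ) (p q r : ℝ) : ℝ :=
  if |p + q + r| ≤ 1 then p ^ k₁ * q ^ k₂ * r ^ k₃ * (-p - q - r) ^ k₄ else 0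

/-- Auxiliary lemma `intQ_eq_Qint` of the Bui–Hall sign-conjecture leg (Theorem structure: symmetries of `∫_Q η^k` under adjacent transpositions of the exponents (scratch, v3)); statement as displayed, box port verbatim. [cite: BuiHall2023, §1 Conjecture 1 — a step of THIS TREE's proof of it (box write-up paper-v3-d979a68f Theorem structure: symmetries of `∫_Q η^k` under adjacent transpositio); the cited paper states the conjecture and the proof is ours] -/
theorem intQ_eq_Qint (k₁ k₂ k₃ k₄ : ℕ) :
    intQ (fun a b e f => a ^ k₁ * b ^ k₂ * e ^ k₃ * f ^ k₄)
      = ∫ p in (-1:ℝ)..1, ∫ q in (-1:ℝ)..1, ∫ r in (-1:ℝ)..1, Qint k₁ k₂ k₃ k₄ p q r := rfl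

/-- Auxiliary lemma `Qint_measurable` of the Bui–Hall sign-conjecture leg (Theorem structure: symmetries of `∫_Q η^k` under adjacent transpositions of the exponents (scratch, v3)); statement as displayed, box port verbatim. [cite: BuiHall2023, §1 Conjecture 1 — a step of THIS TREE's proof of it (box write-up paper-v3-d979a68f Theorem structure: symmetries of `∫_Q η^k` under adjacent transpositio); the cited paper states the conjecture and the proof is ours] -/
theorem Qint_measurable (k₁ k₂ k₃ k₄ : ℕ) : Measurable (fun z : ℝ × ℝ × ℝ => Qint k₁ k₂ k₃ k₄ z.1 z.2.1 z.2.2) := by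
  unfold Qint
  refine Measurable.ite (measurableSet_le (by fun_prop) measurable_const) (by fun_prop) measurable_const

/-- Auxiliary lemma `Qint_abs_le` of the Bui–Hall sign-conjecture leg (Theorem structure: symmetries of `∫_Q η^k` under adjacent transpositions of the exponents (scratch, v3)); statement as displayed, box port verbatim. [cite: BuiHall2023, §1 Conjecture 1 — a step of THIS TREE's proof of it (box write-up paper-v3-d979a68f Theorem structure: symmetries of `∫_Q η^k` under adjacent transpositio); the cited paper states the conjecture and the proof is ours] -/
theorem Qint_abs_le (k₁ k₂ k₃ k₄ : ℕ) {p q r : ℝ} (hp : |p| ≤ 1) (hq : |q| ≤ 1) (hr : |r| ≤ 1) :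
    |Qint k₁ k₂ k₃ k₄ p q r| ≤ 1 := by
  unfold Qint; split_ifs with h
  · have h4 : |(-p - q - r)| ≤ 1 := by rw [show -p - q - r = -(p + q + r) by ring, abs_neg]; exact h
    rw [abs_mul, abs_mul, abs_mul, abs_pow, abs_pow, abs_pow, abs_pow]
    calc |p| ^ k₁ * |q| ^ k₂ * |r| ^ k₃ * |(-p - q - r)| ^ k₄ ≤ 1 ^ k₁ * 1 ^ k₂ * 1 ^ k₃ * 1 ^ k₄ := by gcongr
      _ = 1 := by simp
  · simp

/-- Auxiliary lemma `abs_le_one_of_uIcc11` of the Bui–Hall sign-conjecture leg (Theorem structure: symmetries of `∫_Q η^k` under adjacent transpositions of the exponents (scratch, v3)); statement as displayed, box port verbatim. [cite: BuiHall2023, §1 Conjecture 1 — a step of THIS TREE's proof of it (box write-up paper-v3-d979a68f Theorem structure: symmetries of `∫_Q η^k` under adjacent transpositio); the cited paper states the conjecture and the proof is ours] -/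
theorem abs_le_one_of_uIcc11 {x : ℝ} (hx : x ∈ Set.uIcc (-1:ℝ) 1) : |x| ≤ 1 := by
  rw [Set.uIcc_of_le (by norm_num)] at hx; exact abs_le.mpr ⟨hx.1, hx.2⟩

/-- generic swap of two adjacent `[-1,1]`-integrals of a kernel bounded on the square [cite: BuiHall2023, §1 Conjecture 1 — a step of THIS TREE's proof of it (box write-up paper-v3-d979a68f Theorem structure: symmetries of `∫_Q η^k` under adjacent transpositio); the cited paper states the conjecture and the proof is ours] -/
theorem swap11 {K : ℝ → ℝ → ℝ} (hK : Measurable (Function.uncurry K)) {C : ℝ}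
    (hb : ∀ x ∈ Set.uIoc (-1:ℝ) 1, ∀ y ∈ Set.uIoc (-1:ℝ) 1, |K x y| ≤ C) :
    ∫ x in (-1:ℝ)..1, ∫ y in (-1:ℝ)..1, K x y = ∫ y in (-1:ℝ)..1, ∫ x in (-1:ℝ)..1, K x y := by
  rw [MeasureTheory.intervalIntegral_intervalIntegral_swap]
  refine integrableOn_rect_of_bdd' (K := Function.uncurry K) hK (C := C) ?_
  rintro ⟨x, y⟩ ⟨hx, hy⟩; exact hb x hx y hy

/-- Auxiliary lemma `measurable_param11` of the Bui–Hall sign-conjecture leg (Theorem structure: symmetries of `∫_Q η^k` under adjacent transpositions of the exponents (scratch, v3)); statement as displayed, box port verbatim. [cite: BuiHall2023, §1 Conjecture 1 — a step of THIS TREE's proof of it (box write-up paper-v3-d979a68f Theorem structure: symmetries of `∫_Q η^k` under adjacent transpositio); the cited paper states the conjecture and the proof is ours] -/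
theorem measurable_param11 {α : Type*} [MeasurableSpace α] {K : α → ℝ → ℝ} (hK : Measurable (Function.uncurry K)) :
    Measurable (fun z : α => ∫ y in (-1:ℝ)..1, K z y) := by
  have e : (fun z : α => ∫ y in (-1:ℝ)..1, K z y) = fun z => ∫ y, K z y ∂(volume.restrict (Ioc (-1:ℝ) 1)) := by
    ext z; rw [intervalIntegral.integral_of_le (by norm_num)]
  rw [e]; exact (hK.stronglyMeasurable.integral_prod_right').measurable

/-- (12): `∫_Q η₁^{k₁}η₂^{k₂}η₃^{k₃}η₄^{k₄} = ∫_Q η₁^{k₂}η₂^{k₁}η₃^{k₃}η₄^{k₄}` [cite: BuiHall2023, §1 Conjecture 1 — a step of THIS TREE's proof of it (box write-up paper-v3-d979a68f Theorem structure: symmetries of `∫_Q η^k` under adjacent transpositio); the cited paper states the conjecture and the proof is ours] -/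
theorem intQ_swap12 (k₁ k₂ k₃ k₄ : ℕ) :
    intQ (fun a b e f => a ^ k₁ * b ^ k₂ * e ^ k₃ * f ^ k₄) = intQ (fun a b e f => a ^ k₂ * b ^ k₁ * e ^ k₃ * f ^ k₄) := by
  rw [intQ_eq_Qint, intQ_eq_Qint]
  rw [swap11 (K := fun p q => ∫ r in (-1:ℝ)..1, Qint k₁ k₂ k₃ k₄ p q r) ?_ (C := 2) ?_]
  · apply intervalIntegral.integral_congr; intro a _
    apply intervalIntegral.integral_congr; intro b _
    apply intervalIntegral.integral_congr; intro r _
    unfold Qint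
    rw [show b + a + r = a + b + r by ring]
    split_ifs <;> ring
  · exact measurable_param11 (K := fun (z : ℝ × ℝ) r => Qint k₁ k₂ k₃ k₄ z.1 z.2 r)
      ((Qint_measurable k₁ k₂ k₃ k₄).comp ((measurable_fst.comp measurable_fst).prodMk
        ((measurable_snd.comp measurable_fst).prodMk measurable_snd)))
  · intro p hp q hq
    have := intervalIntegral.norm_integral_le_of_norm_le_const (a := (-1:ℝ)) (b := 1) (C := 1)
      (f := fun r => Qint k₁ k₂ k₃ k₄ p q r) (fun r hr => by
        rw [Real.norm_eq_abs]; exact Qint_abs_le k₁ k₂ k₃ k₄ (abs_le_one_of_mem_uIoc hp) (abs_le_one_of_mem_uIoc hq) (abs_le_one_of_mem_uIoc hr))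
    rw [Real.norm_eq_abs] at this; norm_num at this; linarith

/-- (23) [cite: BuiHall2023, §1 Conjecture 1 — a step of THIS TREE's proof of it (box write-up paper-v3-d979a68f Theorem structure: symmetries of `∫_Q η^k` under adjacent transpositio); the cited paper states the conjecture and the proof is ours] -/
theorem intQ_swap23 (k₁ k₂ k₃ k₄ : ℕ) :
    intQ (fun a b e f => a ^ k₁ * b ^ k₂ * e ^ k₃ * f ^ k₄) = intQ (fun a b e f => a ^ k₁ * b ^ k₃ * e ^ k₂ * f ^ k₄) := by
  rw [intQ_eq_Qint, intQ_eq_Qint]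
  apply intervalIntegral.integral_congr; intro p hp
  have hp1 := abs_le_one_of_uIcc11 hp
  simp only
  rw [swap11 (K := fun q r => Qint k₁ k₂ k₃ k₄ p q r) ?_ (C := 1) ?_]
  · apply intervalIntegral.integral_congr; intro a _
    apply intervalIntegral.integral_congr; intro b _
    unfold Qint
    beta_reduce
    rw [show p + b + a = p + a + b by ring]
    split_ifs <;> ring
  · exact (Qint_measurable k₁ k₂ k₃ k₄).comp (measurable_const.prodMk (measurable_fst.prodMk measurable_snd))
  · intro q hq r hr
    exact Qint_abs_le k₁ k₂ k₃ k₄ hp1 (abs_le_one_of_mem_uIoc hq) (abs_le_one_of_mem_uIoc hr)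

/-- (34): the substitution `r ↦ s = −p−q−r` (as in the chart identity) [cite: BuiHall2023, §1 Conjecture 1 — a step of THIS TREE's proof of it (box write-up paper-v3-d979a68f Theorem structure: symmetries of `∫_Q η^k` under adjacent transpositio); the cited paper states the conjecture and the proof is ours] -/
theorem intQ_swap34 (k₁ k₂ k₃ k₄ : ℕ) :
    intQ (fun a b e f => a ^ k₁ * b ^ k₂ * e ^ k₃ * f ^ k₄) = intQ (fun a b e f => a ^ k₁ * b ^ k₂ * e ^ k₄ * f ^ k₃) := by
  rw [intQ_eq_Qint, intQ_eq_Qint]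
  apply intervalIntegral.integral_congr; intro p _
  apply intervalIntegral.integral_congr; intro q _
  simp only
  set dd := -p - q with hdd
  set g : ℝ → ℝ := fun s => if |s| ≤ 1 then p ^ k₁ * q ^ k₂ * (dd - s) ^ k₃ * s ^ k₄ else 0 with hg
  have e1 : ∀ r, Qint k₁ k₂ k₃ k₄ p q r = g (dd - r) := by
    intro r
    simp only [hg, Qint]
    have habs : |dd - r| = |p + q + r| := by rw [hdd, show -p - q - r = -(p + q + r) by ring, abs_neg]
    rw [habs, sub_sub_cancel]
  simp_rw [e1]
  rw [intervalIntegral.integral_comp_sub_left (fun s => g s) dd, show dd - -1 = dd + 1 by ring, hg, window_swap]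
  apply intervalIntegral.integral_congr; intro s _
  simp only [Qint]
  have habs : |s - dd| = |p + q + s| := by rw [hdd]; ring_nf
  rw [habs, hdd]
  split_ifs <;> ring

/-- `HARDY(k) = i^K · 6·(½)^{K+4}/(K+4) · ∫_Q η^k` (Steps 1–3 of Theorem structure) [cite: BuiHall2023, §1 Conjecture 1 — a step of THIS TREE's proof of it (box write-up paper-v3-d979a68f Theorem structure: symmetries of `∫_Q η^k` under adjacent transpositio); the cited paper states the conjecture and the proof is ours] -/
theorem HARDY_intQ (k₁ k₂ k₃ k₄ : ℕ) :
    HARDY k₁ k₂ k₃ k₄ = Complex.I ^ (k₁ + k₂ + k₃ + k₄)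
      * ((6 * ((1/2 : ℝ) ^ (k₁ + k₂ + k₃ + k₄ + 4) / ((k₁ + k₂ + k₃ + k₄ : ℕ) + 4))
          * intQ (fun a b e f => a ^ k₁ * b ^ k₂ * e ^ k₃ * f ^ k₄) : ℝ) : ℂ) := by
  unfold HARDY
  rw [bhInt_eq_intQ]
  push_cast
  have h1 : ((-1:ℂ) ^ (k₃ + k₄)) ^ 2 = 1 := by
    rw [← pow_mul, mul_comm, pow_mul, neg_one_sq, one_pow]
  linear_combination (Complex.I ^ (k₁ + k₂ + k₃ + k₄) * (6 * ((1/2 : ℂ) ^ (k₁ + k₂ + k₃ + k₄ + 4)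
    / ((k₁ : ℂ) + k₂ + k₃ + k₄ + 4)) * (intQ (fun a b e f => a ^ k₁ * b ^ k₂ * e ^ k₃ * f ^ k₄) : ℂ))) * h1

/-- **Theorem structure (eq. (structureU) + symmetry), PROVED**: `StructureThm` [cite: BuiHall2023, §1 Conjecture 1 — a step of THIS TREE's proof of it (box write-up paper-v3-d979a68f Theorem structure: symmetries of `∫_Q η^k` under adjacent transpositio); the cited paper states the conjecture and the proof is ours] -/
theorem structureThm_holds : StructureThm := by
  refine ⟨fun k₁ k₂ k₃ k₄ => ?_, fun k₁ k₂ k₃ k₄ => ⟨?_, ?_, ?_⟩⟩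
  · rw [HARDY_intQ]
    unfold M
    have h2 : (2:ℂ) ^ (((k₁ + k₂ + k₃ + k₄ : ℕ) : ℤ) - 1) = (2:ℂ) ^ (k₁ + k₂ + k₃ + k₄) / 2 := by
      rw [zpow_sub₀ (by norm_num), zpow_natCast, zpow_one]
    rw [h2]
    have hK : ((k₁ + k₂ + k₃ + k₄ : ℕ) : ℂ) + 4 ≠ 0 := by
      rw [show ((k₁ + k₂ + k₃ + k₄ : ℕ) : ℂ) + 4 = ((k₁ + k₂ + k₃ + k₄ + 4 : ℕ) : ℂ) by push_cast; ring]
      exact Nat.cast_ne_zero.mpr (by omega)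
    have h2K : (2:ℂ) ^ (k₁ + k₂ + k₃ + k₄) ≠ 0 := pow_ne_zero _ (by norm_num)
    have h2K4 : (2:ℂ) ^ (k₁ + k₂ + k₃ + k₄ + 4) ≠ 0 := pow_ne_zero _ (by norm_num)
    push_cast
    rw [one_div_pow]
    field_simp
    ring
  · rw [HARDY_intQ, HARDY_intQ, intQ_swap12 k₂ k₁ k₃ k₄, show k₂ + k₁ + k₃ + k₄ = k₁ + k₂ + k₃ + k₄ by ring]
  · rw [HARDY_intQ, HARDY_intQ, intQ_swap23 k₁ k₃ k₂ k₄, show k₁ + k₃ + k₂ + k₄ = k₁ + k₂ + k₃ + k₄ by ring]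
  · rw [HARDY_intQ, HARDY_intQ, intQ_swap34 k₁ k₂ k₄ k₃, show k₁ + k₂ + k₄ + k₃ = k₁ + k₂ + k₃ + k₄ by ring]

end structsym

/-! ## Assembly of Theorem BH (tex l.228–231) from the pieces -/

section assembly

/-- the positive constant `c_K := 2 / (2^K (K+4)) = 1 / (2^{K-1}(K+4))` of eq. (structureU) [folklore] -/
noncomputable def cK (K : ℕ) : ℝ := 2 / (2 ^ K * ((K : ℝ) + 4))

/-- Auxiliary lemma `cK_pos` of the Bui–Hall sign-conjecture leg (Assembly of Theorem BH (tex l.228–231) from the pieces); statement as displayed, box port verbatim. [cite: BuiHall2023, §1 Conjecture 1 — a step of THIS TREE's proof of it (box write-up paper-v3-d979a68f Assembly of Theorem BH (tex l.228–231) from the pieces); the cited paper states the conjecture and the proof is ours] -/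
theorem cK_pos (K : ℕ) : 0 < cK K := by unfold cK; positivity

/-- Auxiliary lemma `two_zpow_pred_mul` of the Bui–Hall sign-conjecture leg (Assembly of Theorem BH (tex l.228–231) from the pieces); statement as displayed, box port verbatim. [cite: BuiHall2023, §1 Conjecture 1 — a step of THIS TREE's proof of it (box write-up paper-v3-d979a68f Assembly of Theorem BH (tex l.228–231) from the pieces); the cited paper states the conjecture and the proof is ours] -/
theorem two_zpow_pred_mul (K : ℕ) :
    ((2:ℂ) ^ ((K : ℤ) - 1) * ((K : ℕ) + 4)) = (2:ℂ) ^ K * ((K:ℂ) + 4) / 2 := by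
  rw [zpow_sub₀ (by norm_num : (2:ℂ) ≠ 0), zpow_natCast, zpow_one]
  push_cast; ring

/-- Auxiliary lemma `structure_real_form` of the Bui–Hall sign-conjecture leg (Assembly of Theorem BH (tex l.228–231) from the pieces); statement as displayed, box port verbatim. [cite: BuiHall2023, §1 Conjecture 1 — a step of THIS TREE's proof of it (box write-up paper-v3-d979a68f Assembly of Theorem BH (tex l.228–231) from the pieces); the cited paper states the conjecture and the proof is ours] -/
theorem structure_real_form (hS : StructureThm) (k₁ k₂ k₃ k₄ : ℕ) :
    HARDY k₁ k₂ k₃ k₄ = Complex.I ^ (k₁ + k₂ + k₃ + k₄) * ((cK (k₁ + k₂ + k₃ + k₄) * M k₁ k₂ k₃ k₄ : ℝ) : ℂ) := by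
  rw [hS.1 k₁ k₂ k₃ k₄, two_zpow_pred_mul]
  have h2 : (2:ℂ) ^ (k₁ + k₂ + k₃ + k₄) * (((k₁ + k₂ + k₃ + k₄ : ℕ) : ℂ) + 4) ≠ 0 := by
    apply mul_ne_zero (pow_ne_zero _ (by norm_num))
    exact_mod_cast (show ((k₁ + k₂ + k₃ + k₄ : ℕ) + 4 : ℕ) ≠ 0 by omega)
  unfold cK
  push_cast
  field_simp

/-- `M` inherits the symmetry of `HARDY` (Theorem structure): the prefactor depends on `K` only and is non-zero. [cite: BuiHall2023, §1 Conjecture 1 — a step of THIS TREE's proof of it (box write-up paper-v3-d979a68f Assembly of Theorem BH (tex l.228–231) from the pieces); the cited paper states the conjecture and the proof is ours] -/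
theorem M_symm (hS : StructureThm) (k₁ k₂ k₃ k₄ : ℕ) :
    M k₁ k₂ k₃ k₄ = M k₂ k₁ k₃ k₄ ∧ M k₁ k₂ k₃ k₄ = M k₁ k₃ k₂ k₄ ∧ M k₁ k₂ k₃ k₄ = M k₁ k₂ k₄ k₃ := by
  have key : ∀ a b c d a' b' c' d' : ℕ, a + b + c + d = a' + b' + c' + d' →
      HARDY a b c d = HARDY a' b' c' d' → M a b c d = M a' b' c' d' := by
    intro a b c d a' b' c' d' hK hH
    rw [structure_real_form hS, structure_real_form hS, hK] at hH
    have hI : Complex.I ^ (a' + b' + c' + d') ≠ 0 := pow_ne_zero _ Complex.I_ne_zero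
    have h1 := mul_left_cancel₀ hI hH
    have h2 : cK (a' + b' + c' + d') ≠ 0 := (cK_pos _).ne'
    exact mul_left_cancel₀ h2 (by exact_mod_cast h1)
  obtain ⟨s1, s2, s3⟩ := hS.2 k₁ k₂ k₃ k₄
  exact ⟨key _ _ _ _ _ _ _ _ (by ring) s1, key _ _ _ _ _ _ _ _ (by ring) s2, key _ _ _ _ _ _ _ _ (by ring) s3⟩

/-- **The sign of the conditional moment** (eq. (conjM)): `(-1)^{r(k)} M(k) > 0` for every `k` with `K` even, where
`2 r(k) = nOdd k` is the number of odd orders — from the three parity cases: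
all even (Corollary signs (a)), all odd (Proposition oddodd with Lemma C), exactly two odd (Proposition 11family
via (spade), Proposition reduce and Theorem master), the placements being reduced by symmetry. [cite: BuiHall2023, §1 Conjecture 1 — a step of THIS TREE's proof of it (box write-up paper-v3-d979a68f Assembly of Theorem BH (tex l.228–231) from the pieces); the cited paper states the conjecture and the proof is ours] -/
theorem conjM_sign (hS : StructureThm) (hCh : ChartIdentity) (hEven : AllEvenPos) (hOdd : OddOddCore)
    (hEleven : ElevenCore) (hRed : Reduction) (hLC : LemmaCConclusions) (hMaster : MasterIneq)
    (k₁ k₂ k₃ k₄ : ℕ) (hK : Even (k₁ + k₂ + k₃ + k₄)) :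
    0 < (-1 : ℝ) ^ (nOdd k₁ k₂ k₃ k₄ / 2) * M k₁ k₂ k₃ k₄ := by
  have spade : ∀ c d, Spade c d := hRed hMaster
  -- the two-odd case in normal position, and the all-odd case
  have twoOdd : ∀ c d a b : ℕ, M (2 * c + 1) (2 * d + 1) (2 * a) (2 * b) < 0 := by
    intro c d a b
    rw [hCh.1]
    have := hEleven c d (hLC c d).2 (spade c d) a b
    linarith
  have allOdd : ∀ c d a b : ℕ, 0 < M (2 * c + 1) (2 * d + 1) (2 * a + 1) (2 * b + 1) := by
    intro c d a b
    rw [hCh.2]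
    have := hOdd c d (hLC c d).1 a b
    linarith
  -- parities
  obtain ⟨q₁, hq₁⟩ := Nat.even_or_odd' k₁
  obtain ⟨q₂, hq₂⟩ := Nat.even_or_odd' k₂
  obtain ⟨q₃, hq₃⟩ := Nat.even_or_odd' k₃
  obtain ⟨q₄, hq₄⟩ := Nat.even_or_odd' k₄
  have sym := fun a b c d => M_symm hS a b c d
  rcases hq₁ with rfl | rfl <;> rcases hq₂ with rfl | rfl <;> rcases hq₃ with rfl | rfl <;>
    rcases hq₄ with rfl | rfl
  all_goals simp only [nOdd, Nat.mul_mod_right, Nat.mul_add_mod] ; norm_num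
  -- 16 parity patterns; the 8 with an odd number of odd entries contradict `hK`
  all_goals first
    | (exfalso; obtain ⟨t, ht⟩ := hK; omega)
    | skip
  · exact hEven q₁ q₂ q₃ q₄
  · -- (even, even, odd, odd): move the odd pair to the front
    have e1 := (sym (2*q₁) (2*q₂) (2*q₃+1) (2*q₄+1)).2.1      -- swap 2,3
    have e2 := (sym (2*q₁) (2*q₃+1) (2*q₂) (2*q₄+1)).1        -- swap 1,2
    have e3 := (sym (2*q₃+1) (2*q₁) (2*q₂) (2*q₄+1)).2.2      -- swap 3,4
    have e4 := (sym (2*q₃+1) (2*q₁) (2*q₄+1) (2*q₂)).2.1      -- swap 2,3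
    rw [e1, e2, e3, e4]; linarith [twoOdd q₃ q₄ q₁ q₂]
  · -- (even, odd, even, odd)
    have e1 := (sym (2*q₁) (2*q₂+1) (2*q₃) (2*q₄+1)).1        -- swap 1,2
    have e2 := (sym (2*q₂+1) (2*q₁) (2*q₃) (2*q₄+1)).2.2      -- swap 3,4
    have e3 := (sym (2*q₂+1) (2*q₁) (2*q₄+1) (2*q₃)).2.1      -- swap 2,3
    rw [e1, e2, e3]; linarith [twoOdd q₂ q₄ q₁ q₃]
  · -- (even, odd, odd, even)
    have e1 := (sym (2*q₁) (2*q₂+1) (2*q₃+1) (2*q₄)).1        -- swap 1,2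
    have e2 := (sym (2*q₂+1) (2*q₁) (2*q₃+1) (2*q₄)).2.1      -- swap 2,3
    rw [e1, e2]; linarith [twoOdd q₂ q₃ q₁ q₄]
  · -- (odd, even, even, odd)
    have e1 := (sym (2*q₁+1) (2*q₂) (2*q₃) (2*q₄+1)).2.2      -- swap 3,4
    have e2 := (sym (2*q₁+1) (2*q₂) (2*q₄+1) (2*q₃)).2.1      -- swap 2,3
    rw [e1, e2]; linarith [twoOdd q₁ q₄ q₂ q₃]
  · -- (odd, even, odd, even)
    have e1 := (sym (2*q₁+1) (2*q₂) (2*q₃+1) (2*q₄)).2.1      -- swap 2,3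
    rw [e1]; linarith [twoOdd q₁ q₃ q₂ q₄]
  · -- (odd, odd, even, even)
    linarith [twoOdd q₁ q₂ q₃ q₄]
  · exact allOdd q₁ q₂ q₃ q₄

end assembly




/-- Discharge BY NAME of the intermediate Prop `StructureThm` (box write-up Thm. 1): it is the theorem `structureThm_holds` of this module. [cite: BuiHall2023, §1 Conjecture 1 — a step of THIS TREE's proof of it (box write-up paper-v3-d979a68f Thm. 1); the cited paper states the conjecture and the proof is ours] -/
theorem StructureThm_holds : StructureThm := structureThm_holds

end Literature.NumberTheory.LFunctions.BuiHall
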